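import Summits.BirchSwinnertonDyer.BirchSwinnertonDyer.Theorems.AdditiveKolyvaginRoadLevelSystems
import Summits.BirchSwinnertonDyer.Rank1Residual.JET.ZhangKolyvaginPrimeGross
import Literature.NumberTheory.EllipticCurves.ZhangLevelRaisedKolyvaginData
import Mathlib.Data.Nat.Squarefree
import HarnessLib

/-!
# Route `AdditiveKolyvaginRoad`, crux KS′ `LevelKolyvaginSystemsAdditive` (item stmt-BirchSwinnertonDyer-21396): the SUMMIT-SIDE
# DICTIONARY for stub S5a `stub_lenderBipartiteDatum` of line `epsilon_matched_retyping` (S5A-ROADMAP item D1) — from a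
# LITERATURE-INDEXED level-raised datum of the lender `E₀` (levels `m : Finset ℕ`, Kolyvagin conductors `n : ℕ`, W. Zhang's letters)
# to the carrier's subtype-indexed datum `(ε₀, κ₀, lam)` with its nine rows (cell `pub/bsd-wall`, width seat `bsd-wall-akr-p2x-w2` g4;
# `--supports stmt-BirchSwinnertonDyer-21396`, helper; namespace `…Theorems.AdditiveKoly.LenderDatum`)

WHY. Stub S5a asks for the lender's bipartite datum K1(E₀) in the carrier's indexing: conductors `m : Finset {ℓ // Zhang2014.IsKolyvaginPrime
N₀ W₀ K p ℓ}`, levels `n : Finset (AdmQ W₀ K p)`, classes in `Vp W₀ K p = H¹(K, E₀[p¹])`. The Literature side (W. Zhang 2014 §3–§4,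
§8.1; carrier `ZhangLevelRaisedKolyvaginData`, the named facts L1/L2/L3 of the roadmap) indexes levels by `Finset ℕ` of admissible primes
(`IsZhangAdmissibleLevel`) and conductors by square-free naturals (`IsKolyvaginLevel`, Gross's Kolyvagin primes). This file is the
provable glue: GIVEN ℕ-indexed signs/classes/values `(εℕ, κℕ, lamℕ)` satisfying the nine rows in ℕ-indexed form (the shapes the Literature
facts are to supply), it PRODUCES S5a's conclusion verbatim — `ε₀ n := εℕ (n.image val)`, `κ₀ m n := κℕ (n.image val) (∏ ℓ ∈ m, ℓ)`,
`lam m n := lamℕ (n.image val) (∏ ℓ ∈ m, ℓ)` — with the index arithmetic (images of subtype finsets are admissible levels of the same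
cardinality; products of distinct Zhang–Kolyvagin primes are square-free Gross–Kolyvagin conductors, `isKolyvaginPrime_of_zhang`, with
the right prime-factor count and `insert ↔ multiplication`).

WHAT. §1 index glue (`image_val_isZhangAdmissibleLevel`, `card_image_val`, `val_notMem_image`, `image_val_insert`, `primeFactors_prod_val`,
`isKolyvaginLevel_prod_val`, `card_primeFactors_prod_val`, `prod_val_insert`, `not_dvd_prod_val`). §2 **`lenderBipartiteDatum_of_natIndexed`**.

HONEST FRAMING: theorems only; 0 definitions, 0 named facts, 0 `sorry`; pure bookkeeping — the nine ℕ-indexed rows are HYPOTHESES (to be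
discharged by the Literature facts L1–L3 over W. Zhang 2014, typing in progress by the lead / w3). Closes nothing by itself; BSD is not proved by
any of this; KS′ is not proved.

References: [cite: WZhang2014, Notations (xii), (xiv); §3.7 (3.21)–(3.22); Thm. 4.3; §8.1] [cite: BertoliniDarmon2005, §2.2, Thm. 4.1–4.2]
[cite: GrossLMS1991, §3 (3.1)–(3.3)].
-/

set_option linter.dupNamespace false -- single-conjunct summit repeats the name by design
set_option autoImplicit false

noncomputable section

open scoped Classical

namespace Summit.BirchSwinnertonDyer.BirchSwinnertonDyer.Theorems.AdditiveKoly.LenderDatum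

open WeierstrassCurve NumberField IsDedekindDomain Field
  Literature.NumberTheory.EllipticCurves Literature.NumberTheory.EllipticCurves.ModularForms
  Literature.NumberTheory.EllipticCurves.Rank1Residual Literature.NumberTheory.GaloisRepresentations
  Summit.BirchSwinnertonDyer.Rank1Residual

/-! ## §1 Index glue -/

section Index

variable (W₀ : WeierstrassCurve ℚ) [W₀.IsGloballyMinimal] (K : Type) [Field K] [NumberField K] (p : ℕ)

omit [NumberField K] in
/-- The image of a finset of admissible primes (the carrier's `AdmQ`) is an admissible level in W. Zhang's sense.
[cite: WZhang2014, Notations (xiv)] -/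
theorem image_val_isZhangAdmissibleLevel (n : Finset (AdmQ W₀ K p)) :
    IsZhangAdmissibleLevel (W₀.conductorNorm ℤ) K (fun ℓ ↦ W₀.frobeniusTrace ℓ) p (n.image Subtype.val) := by
  intro q hq
  obtain ⟨q', -, rfl⟩ := Finset.mem_image.mp hq
  exact q'.2

omit [NumberField K] in
/-- `#(n.image val) = #n`. [folklore] -/
theorem card_image_val {P : ℕ → Prop} (n : Finset {q // P q}) : (n.image Subtype.val).card = n.card :=
  Finset.card_image_of_injective _ Subtype.val_injective

omit [NumberField K] in
/-- `q ∉ n ⟹ q.val ∉ n.image val`. [folklore] -/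
theorem val_notMem_image {P : ℕ → Prop} {n : Finset {q // P q}} {q : {q // P q}} (hq : q ∉ n) :
    q.1 ∉ n.image Subtype.val := by
  intro h
  obtain ⟨q', hq', hqq⟩ := Finset.mem_image.mp h
  exact hq (Subtype.val_injective hqq ▸ hq')

omit [NumberField K] in
/-- `(insert q n).image val = insert q.val (n.image val)`. [folklore] -/
theorem image_val_insert {P : ℕ → Prop} (n : Finset {q // P q}) (q : {q // P q}) :
    (insert q n).image Subtype.val = insert q.1 (n.image Subtype.val) :=
  Finset.image_insert _ _ _

/-- The prime factors of `∏ ℓ ∈ m, ℓ` for a finset `m` of Zhang–Kolyvagin primes are `m.image val`. [folklore] -/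
theorem primeFactors_prod_val (m : Finset {ℓ // Zhang2014.IsKolyvaginPrime (W₀.conductorNorm ℤ) W₀ K p ℓ}) :
    (∏ ℓ ∈ m, (ℓ : ℕ)).primeFactors = m.image Subtype.val := by
  rw [← Finset.prod_image (s := m) (g := Subtype.val) (f := fun x : ℕ ↦ x)
    (fun x _ y _ h ↦ Subtype.val_injective h)]
  exact Nat.primeFactors_prod fun q hq ↦ by
    obtain ⟨q', -, rfl⟩ := Finset.mem_image.mp hq
    exact q'.2.1

/-- `ν(∏ ℓ ∈ m, ℓ) = #m`. [folklore] -/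
theorem card_primeFactors_prod_val (m : Finset {ℓ // Zhang2014.IsKolyvaginPrime (W₀.conductorNorm ℤ) W₀ K p ℓ}) :
    (∏ ℓ ∈ m, (ℓ : ℕ)).primeFactors.card = m.card := by
  rw [primeFactors_prod_val, card_image_val]

/-- **Products of distinct Zhang–Kolyvagin primes are Kolyvagin conductors `n ∈ Λ` in Gross's sense** (square-free, every prime factor a
Gross–Kolyvagin prime: `isKolyvaginPrime_of_zhang`, which needs `p` odd, `K` imaginary quadratic and `ρ̄` onto).
[cite: WZhang2014, Notations (xii)] [cite: GrossLMS1991, §3 (3.1)–(3.3)] -/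
theorem isKolyvaginLevel_prod_val [W₀.IsElliptic] [Fact p.Prime] (hK : IsImaginaryQuadratic K) (hp2 : p ≠ 2) (hs : W₀.HasSurjectiveModNGaloisRep p)
    (m : Finset {ℓ // Zhang2014.IsKolyvaginPrime (W₀.conductorNorm ℤ) W₀ K p ℓ}) :
    IsKolyvaginLevel (W₀.conductorNorm ℤ) W₀ K p (∏ ℓ ∈ m, (ℓ : ℕ)) := by
  refine ⟨?_, fun ℓ hℓ ↦ ?_⟩
  · refine Finset.squarefree_prod_of_pairwise_isCoprime ?_ (fun ℓ _ ↦ ℓ.2.1.squarefree)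
    intro x _ y _ hxy
    have hne : (x : ℕ) ≠ y := fun h ↦ hxy (Subtype.val_injective h)
    exact Nat.coprime_iff_isRelPrime.mp ((Nat.coprime_primes x.2.1 y.2.1).mpr hne)
  · rw [primeFactors_prod_val] at hℓ
    obtain ⟨ℓ', -, rfl⟩ := Finset.mem_image.mp hℓ
    exact JET.ZhangGross.isKolyvaginPrime_of_zhang W₀ K hK hp2 hs ℓ'.2

/-- `∏ ℓ ∈ insert ℓ m, ℓ = (∏ ℓ ∈ m, ℓ) · ℓ` for `ℓ ∉ m`. [folklore] -/
theorem prod_val_insert {m : Finset {ℓ // Zhang2014.IsKolyvaginPrime (W₀.conductorNorm ℤ) W₀ K p ℓ}}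
    {ℓ : {ℓ // Zhang2014.IsKolyvaginPrime (W₀.conductorNorm ℤ) W₀ K p ℓ}} (hℓ : ℓ ∉ m) :
    (∏ x ∈ insert ℓ m, (x : ℕ)) = (∏ x ∈ m, (x : ℕ)) * ℓ := by
  rw [Finset.prod_insert hℓ, mul_comm]

/-- `ℓ ∤ ∏ x ∈ m, x` for a Zhang–Kolyvagin prime `ℓ ∉ m`. [folklore] -/
theorem not_dvd_prod_val {m : Finset {ℓ // Zhang2014.IsKolyvaginPrime (W₀.conductorNorm ℤ) W₀ K p ℓ}}
    {ℓ : {ℓ // Zhang2014.IsKolyvaginPrime (W₀.conductorNorm ℤ) W₀ K p ℓ}} (hℓ : ℓ ∉ m) :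
    ¬ (ℓ : ℕ) ∣ ∏ x ∈ m, (x : ℕ) := by
  intro h
  have hmem : (ℓ : ℕ) ∈ (∏ x ∈ m, (x : ℕ)).primeFactors :=
    Nat.mem_primeFactors.mpr ⟨ℓ.2.1, h, Finset.prod_ne_zero_iff.mpr fun x _ ↦ x.2.1.ne_zero⟩
  rw [primeFactors_prod_val] at hmem
  exact val_notMem_image hℓ hmem

end Index

/-! ## §2 The dictionary -/

section Dictionary

variable (W₀ : WeierstrassCurve ℚ) [W₀.IsElliptic] [W₀.IsGloballyMinimal] [NeZero (W₀.conductorNorm ℤ)] (p : ℕ) [Fact p.Prime]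
  (K : Type) [Field K] [NumberField K] (Dt₀ : ModularParametrizationData W₀ (W₀.conductorNorm ℤ)) (β₀ : ℤ) (ι : K →+* ℂ)
  (c : K ≃ₐ[ℚ] K)

/-- **THE DICTIONARY (S5A-ROADMAP, D1).** Let `E₀ = W₀` with `K` imaginary quadratic, `p` odd, `ρ̄_{E₀,p}` onto. Suppose given
ℕ-INDEXED level-raised data of the lender — signs `εℕ : Finset ℕ → Bool`, classes `κℕ : Finset ℕ → ℕ → H¹(K, E₀[p¹])` and odd-level
values `lamℕ : Finset ℕ → ℕ → 𝔽_p` (W. Zhang's letters: LEVEL `m : Finset ℕ` of admissible primes, CONDUCTOR `n ∈ Λ`) — satisfying the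
nine rows of K1(E₀) in ℕ-indexed form: REALISATION at level `∅` by Kolyvagin–Heegner data of conductor `n` [(3.21)–(3.22)], and at every
non-empty even admissible level the SIGN (Gross 5.4 (2) / §8.2), E₀'s KUMMER condition off `n ∪ m` [§8.1 (1) + Thm. 5.2], the archimedean
condition, the TORIC condition at the level primes [Thm. 4.3 (4.3)], the TRANSVERSE condition at the conductor primes [§8.1 (1)], the relation
(8.1) in the «= 0 ⟺ = 0» form, and the two reciprocity laws [Thm. 4.3 (4.5) / BD05 Thm. 4.1–4.2] in the «value non-zero ⟺ class locally
non-trivial» form. THEN the carrier's datum exists: S5a's conclusion VERBATIM (`ε₀ n := εℕ (n.image val)`,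
`κ₀ m n := κℕ (n.image val) (∏ ℓ ∈ m, ℓ)`, `lam m n := lamℕ (n.image val) (∏ ℓ ∈ m, ℓ)`).
[cite: WZhang2014, §3.7 (3.21)–(3.22), Thm. 4.3, §8.1] [cite: BertoliniDarmon2005, Thm. 4.1–4.2] [cite: GrossLMS1991, Prop. 5.4 (2)] -/
theorem lenderBipartiteDatum_of_natIndexed (hK : IsImaginaryQuadratic K) (hp2 : p ≠ 2) (hs₀ : W₀.HasSurjectiveModNGaloisRep p)
    [Module (ZMod p) (Vp W₀ K p)]
    (εℕ : Finset ℕ → Bool) (κℕ : Finset ℕ → ℕ → Vp W₀ K p) (lamℕ : Finset ℕ → ℕ → ZMod p)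
    (hR : ∀ n : ℕ, IsKolyvaginLevel (W₀.conductorNorm ℤ) W₀ K p n →
      ∃ d : KolyvaginHeegnerData Dt₀ β₀ ι n, κℕ ∅ n = d.kolyvaginClass (Fact.out : p.Prime) 1)
    (hS : ∀ m : Finset ℕ, IsZhangAdmissibleLevel (W₀.conductorNorm ℤ) K (fun ℓ ↦ W₀.frobeniusTrace ℓ) p m → m.Nonempty →
      Even m.card → ∀ n : ℕ, IsKolyvaginLevel (W₀.conductorNorm ℤ) W₀ K p n →
      conjAct W₀ c ((p ^ 1 : ℕ) : ℤ) (κℕ m n) = sgnP (εℕ m ^^ Nat.bodd n.primeFactors.card) • κℕ m n)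
    (hKoff : ∀ m : Finset ℕ, IsZhangAdmissibleLevel (W₀.conductorNorm ℤ) K (fun ℓ ↦ W₀.frobeniusTrace ℓ) p m → m.Nonempty →
      Even m.card → ∀ n : ℕ, IsKolyvaginLevel (W₀.conductorNorm ℤ) W₀ K p n →
      ∀ v : HeightOneSpectrum (𝓞 K), (∀ ℓ ∈ n.primeFactors, ((ℓ : ℕ) : 𝓞 K) ∉ v.asIdeal) →
        (∀ q ∈ m, ((q : ℕ) : 𝓞 K) ∉ v.asIdeal) →
        κℕ m n ∈ selmerLocalKer (W₀.baseChange K) (v.adicCompletion K) ((p ^ 1 : ℕ) : ℤ))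
    (hKinf : ∀ m : Finset ℕ, IsZhangAdmissibleLevel (W₀.conductorNorm ℤ) K (fun ℓ ↦ W₀.frobeniusTrace ℓ) p m → m.Nonempty →
      Even m.card → ∀ n : ℕ, IsKolyvaginLevel (W₀.conductorNorm ℤ) W₀ K p n →
      ∀ w : InfinitePlace K, κℕ m n ∈ selmerLocalKer (W₀.baseChange K) w.Completion ((p ^ 1 : ℕ) : ℤ))
    (hT : ∀ m : Finset ℕ, IsZhangAdmissibleLevel (W₀.conductorNorm ℤ) K (fun ℓ ↦ W₀.frobeniusTrace ℓ) p m → m.Nonempty →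
      Even m.card → ∀ n : ℕ, IsKolyvaginLevel (W₀.conductorNorm ℤ) W₀ K p n →
      ∀ q ∈ m, ∀ v : HeightOneSpectrum (𝓞 K), ((q : ℕ) : 𝓞 K) ∈ v.asIdeal →
        κℕ m n ∈ toricLocalKer (W₀.baseChange K) (v.adicCompletion K) ((p ^ 1 : ℕ) : ℤ))
    (hTr : ∀ m : Finset ℕ, IsZhangAdmissibleLevel (W₀.conductorNorm ℤ) K (fun ℓ ↦ W₀.frobeniusTrace ℓ) p m → m.Nonempty →
      Even m.card → ∀ n : ℕ, IsKolyvaginLevel (W₀.conductorNorm ℤ) W₀ K p n →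
      ∀ ℓ ∈ n.primeFactors, ∀ v : HeightOneSpectrum (𝓞 K), ((ℓ : ℕ) : 𝓞 K) ∈ v.asIdeal →
        κℕ m n ∈ transverseLocalKerP W₀ K p ι ℓ v)
    (hRel : ∀ m : Finset ℕ, IsZhangAdmissibleLevel (W₀.conductorNorm ℤ) K (fun ℓ ↦ W₀.frobeniusTrace ℓ) p m → m.Nonempty →
      Even m.card → ∀ n : ℕ, IsKolyvaginLevel (W₀.conductorNorm ℤ) W₀ K p n →
      ∀ ℓ : ℕ, Zhang2014.IsKolyvaginPrime (W₀.conductorNorm ℤ) W₀ K p ℓ → ¬ ℓ ∣ n →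
      ∀ v : HeightOneSpectrum (𝓞 K), ((ℓ : ℕ) : 𝓞 K) ∈ v.asIdeal →
        (κℕ m (n * ℓ) ∈ (W₀.baseChange K).torsionLocalKer (v.adicCompletion K) ((p ^ 1 : ℕ) : ℤ) ↔
          κℕ m n ∈ (W₀.baseChange K).torsionLocalKer (v.adicCompletion K) ((p ^ 1 : ℕ) : ℤ)))
    (hA : ∀ (m : Finset ℕ) (q : ℕ), IsZhangAdmissibleLevel (W₀.conductorNorm ℤ) K (fun ℓ ↦ W₀.frobeniusTrace ℓ) p (insert q m) →
      Even m.card → q ∉ m → ∀ n : ℕ, IsKolyvaginLevel (W₀.conductorNorm ℤ) W₀ K p n →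
      (lamℕ (insert q m) n ≠ 0 ↔ ∃ v : HeightOneSpectrum (𝓞 K), ((q : ℕ) : 𝓞 K) ∈ v.asIdeal ∧
        κℕ m n ∉ (W₀.baseChange K).torsionLocalKer (v.adicCompletion K) ((p ^ 1 : ℕ) : ℤ)))
    (hB : ∀ (m : Finset ℕ) (q : ℕ), IsZhangAdmissibleLevel (W₀.conductorNorm ℤ) K (fun ℓ ↦ W₀.frobeniusTrace ℓ) p (insert q m) →
      Odd m.card → q ∉ m → ∀ n : ℕ, IsKolyvaginLevel (W₀.conductorNorm ℤ) W₀ K p n →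
      ((∃ v : HeightOneSpectrum (𝓞 K), ((q : ℕ) : 𝓞 K) ∈ v.asIdeal ∧
        κℕ (insert q m) n ∉ (W₀.baseChange K).torsionLocalKer (v.adicCompletion K) ((p ^ 1 : ℕ) : ℤ)) ↔ lamℕ m n ≠ 0)) :
    ∃ (ε₀ : Finset (AdmQ W₀ K p) → Bool)
      (κ₀ : Finset {ℓ // Zhang2014.IsKolyvaginPrime (W₀.conductorNorm ℤ) W₀ K p ℓ} → Finset (AdmQ W₀ K p) → Vp W₀ K p)
      (lam : Finset {ℓ // Zhang2014.IsKolyvaginPrime (W₀.conductorNorm ℤ) W₀ K p ℓ} → Finset (AdmQ W₀ K p) → ZMod p),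
      -- realisation at level `∅`
      (∀ m : Finset {ℓ // Zhang2014.IsKolyvaginPrime (W₀.conductorNorm ℤ) W₀ K p ℓ},
        ∃ d : KolyvaginHeegnerData Dt₀ β₀ ι (∏ ℓ ∈ m, (ℓ : ℕ)), κ₀ m ∅ = d.kolyvaginClass (Fact.out : p.Prime) 1) ∧
      -- sign
      (∀ n : Finset (AdmQ W₀ K p), n.Nonempty → Even n.card →
        ∀ m : Finset {ℓ // Zhang2014.IsKolyvaginPrime (W₀.conductorNorm ℤ) W₀ K p ℓ},
        conjAct W₀ c ((p ^ 1 : ℕ) : ℤ) (κ₀ m n) = sgnP (ε₀ n ^^ Nat.bodd m.card) • κ₀ m n) ∧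
      -- selmer_off
      (∀ n : Finset (AdmQ W₀ K p), n.Nonempty → Even n.card →
        ∀ (m : Finset {ℓ // Zhang2014.IsKolyvaginPrime (W₀.conductorNorm ℤ) W₀ K p ℓ}) (v : HeightOneSpectrum (𝓞 K)),
        (∀ ℓ ∈ m, ((ℓ : ℕ) : 𝓞 K) ∉ v.asIdeal) → (∀ q ∈ n, ((q : ℕ) : 𝓞 K) ∉ v.asIdeal) →
        κ₀ m n ∈ selmerLocalKer (W₀.baseChange K) (v.adicCompletion K) ((p ^ 1 : ℕ) : ℤ)) ∧
      -- selmer_inf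
      (∀ n : Finset (AdmQ W₀ K p), n.Nonempty → Even n.card →
        ∀ (m : Finset {ℓ // Zhang2014.IsKolyvaginPrime (W₀.conductorNorm ℤ) W₀ K p ℓ}) (w : InfinitePlace K),
        κ₀ m n ∈ selmerLocalKer (W₀.baseChange K) w.Completion ((p ^ 1 : ℕ) : ℤ)) ∧
      -- toric_on
      (∀ n : Finset (AdmQ W₀ K p), n.Nonempty → Even n.card →
        ∀ m : Finset {ℓ // Zhang2014.IsKolyvaginPrime (W₀.conductorNorm ℤ) W₀ K p ℓ}, ∀ q ∈ n,
        ∀ v : HeightOneSpectrum (𝓞 K), ((q : ℕ) : 𝓞 K) ∈ v.asIdeal →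
        κ₀ m n ∈ toricLocalKer (W₀.baseChange K) (v.adicCompletion K) ((p ^ 1 : ℕ) : ℤ)) ∧
      -- transverse_on
      (∀ n : Finset (AdmQ W₀ K p), n.Nonempty → Even n.card →
        ∀ m : Finset {ℓ // Zhang2014.IsKolyvaginPrime (W₀.conductorNorm ℤ) W₀ K p ℓ}, ∀ ℓ ∈ m,
        ∀ v : HeightOneSpectrum (𝓞 K), ((ℓ : ℕ) : 𝓞 K) ∈ v.asIdeal → κ₀ m n ∈ transverseLocalKerP W₀ K p ι ℓ v) ∧
      -- relation (8.1)
      (∀ n : Finset (AdmQ W₀ K p), n.Nonempty → Even n.card →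
        ∀ (m : Finset {ℓ // Zhang2014.IsKolyvaginPrime (W₀.conductorNorm ℤ) W₀ K p ℓ})
          (ℓ : {ℓ // Zhang2014.IsKolyvaginPrime (W₀.conductorNorm ℤ) W₀ K p ℓ}), ℓ ∉ m →
        ∀ v : HeightOneSpectrum (𝓞 K), ((ℓ : ℕ) : 𝓞 K) ∈ v.asIdeal →
        (κ₀ (insert ℓ m) n ∈ (W₀.baseChange K).torsionLocalKer (v.adicCompletion K) ((p ^ 1 : ℕ) : ℤ) ↔
          κ₀ m n ∈ (W₀.baseChange K).torsionLocalKer (v.adicCompletion K) ((p ^ 1 : ℕ) : ℤ))) ∧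
      -- law (A)
      (∀ (n : Finset (AdmQ W₀ K p)) (q : AdmQ W₀ K p), Even n.card → q ∉ n →
        ∀ m : Finset {ℓ // Zhang2014.IsKolyvaginPrime (W₀.conductorNorm ℤ) W₀ K p ℓ},
        lam m (insert q n) ≠ 0 ↔ ∃ v : HeightOneSpectrum (𝓞 K), ((q : ℕ) : 𝓞 K) ∈ v.asIdeal ∧
          κ₀ m n ∉ (W₀.baseChange K).torsionLocalKer (v.adicCompletion K) ((p ^ 1 : ℕ) : ℤ)) ∧
      -- law (B)
      (∀ (n : Finset (AdmQ W₀ K p)) (q : AdmQ W₀ K p), Odd n.card → q ∉ n →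
        ∀ m : Finset {ℓ // Zhang2014.IsKolyvaginPrime (W₀.conductorNorm ℤ) W₀ K p ℓ},
        (∃ v : HeightOneSpectrum (𝓞 K), ((q : ℕ) : 𝓞 K) ∈ v.asIdeal ∧
          κ₀ m (insert q n) ∉ (W₀.baseChange K).torsionLocalKer (v.adicCompletion K) ((p ^ 1 : ℕ) : ℤ)) ↔
          lam m n ≠ 0) := by
  -- abbreviations for the index translation
  have hadm : ∀ n : Finset (AdmQ W₀ K p),
      IsZhangAdmissibleLevel (W₀.conductorNorm ℤ) K (fun ℓ ↦ W₀.frobeniusTrace ℓ) p (n.image Subtype.val) :=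
    image_val_isZhangAdmissibleLevel W₀ K p
  have hkol : ∀ m : Finset {ℓ // Zhang2014.IsKolyvaginPrime (W₀.conductorNorm ℤ) W₀ K p ℓ},
      IsKolyvaginLevel (W₀.conductorNorm ℤ) W₀ K p (∏ ℓ ∈ m, (ℓ : ℕ)) :=
    isKolyvaginLevel_prod_val W₀ K p hK hp2 hs₀
  have hne : ∀ n : Finset (AdmQ W₀ K p), n.Nonempty → (n.image Subtype.val).Nonempty :=
    fun n hn ↦ Finset.image_nonempty.mpr hn
  have hev : ∀ n : Finset (AdmQ W₀ K p), Even n.card → Even (n.image Subtype.val).card :=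
    fun n hn ↦ by rwa [card_image_val]
  have hodd : ∀ n : Finset (AdmQ W₀ K p), Odd n.card → Odd (n.image Subtype.val).card :=
    fun n hn ↦ by rwa [card_image_val]
  refine ⟨fun n ↦ εℕ (n.image Subtype.val), fun m n ↦ κℕ (n.image Subtype.val) (∏ ℓ ∈ m, (ℓ : ℕ)),
    fun m n ↦ lamℕ (n.image Subtype.val) (∏ ℓ ∈ m, (ℓ : ℕ)), ?_, ?_, ?_, ?_, ?_, ?_, ?_, ?_, ?_⟩
  · -- realisation
    intro m
    simpa only [Finset.image_empty] using hR _ (hkol m)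
  · -- sign
    intro n hn hev' m
    have h := hS _ (hadm n) (hne n hn) (hev n hev') _ (hkol m)
    rwa [card_primeFactors_prod_val] at h
  · -- selmer_off
    intro n hn hev' m v hm hq
    refine hKoff _ (hadm n) (hne n hn) (hev n hev') _ (hkol m) v (fun ℓ hℓ ↦ ?_) (fun q hq' ↦ ?_)
    · rw [primeFactors_prod_val] at hℓ
      obtain ⟨ℓ', hℓ', rfl⟩ := Finset.mem_image.mp hℓ
      exact hm ℓ' hℓ'
    · obtain ⟨q', hq'', rfl⟩ := Finset.mem_image.mp hq'
      exact hq q' hq''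
  · -- selmer_inf
    intro n hn hev' m w
    exact hKinf _ (hadm n) (hne n hn) (hev n hev') _ (hkol m) w
  · -- toric_on
    intro n hn hev' m q hq v hv
    exact hT _ (hadm n) (hne n hn) (hev n hev') _ (hkol m) q.1 (Finset.mem_image_of_mem _ hq) v hv
  · -- transverse_on
    intro n hn hev' m ℓ hℓ v hv
    refine hTr _ (hadm n) (hne n hn) (hev n hev') _ (hkol m) ℓ.1 ?_ v hv
    rw [primeFactors_prod_val]
    exact Finset.mem_image_of_mem _ hℓ
  · -- relation (8.1)
    intro n hn hev' m ℓ hℓ v hv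
    beta_reduce
    rw [prod_val_insert W₀ K p hℓ]
    exact hRel _ (hadm n) (hne n hn) (hev n hev') _ (hkol m) ℓ.1 ℓ.2 (not_dvd_prod_val W₀ K p hℓ) v hv
  · -- law (A)
    intro n q hev' hq m
    have h := hA (n.image Subtype.val) q.1 (by rw [← image_val_insert]; exact hadm (insert q n)) (hev n hev')
      (val_notMem_image hq) _ (hkol m)
    rwa [← image_val_insert] at h
  · -- law (B)
    intro n q hodd' hq m
    have h := hB (n.image Subtype.val) q.1 (by rw [← image_val_insert]; exact hadm (insert q n)) (hodd n hodd')
      (val_notMem_image hq) _ (hkol m)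
    rwa [← image_val_insert] at h

end Dictionary

end Summit.BirchSwinnertonDyer.BirchSwinnertonDyer.Theorems.AdditiveKoly.LenderDatum

end
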